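import Literature.AlgebraicGeometry.Frobenioids.FrobeniusConjugates
import Literature.AlgebraicGeometry.Frobenioids.IsotropicFrobenioid
import Literature.AlgebraicGeometry.Frobenioids.IsotropicFrobeniusTrivial
import Mathlib.CategoryTheory.Conj
import HarnessLib

/-!
# Frobenioids I, Proposition 1.10 (vi): `C^istr` is of sub-quasi-Frobenius-trivial type

Mochizuki, *The geometry of Frobenioids I: the general theory*, Kyushu J. Math. **62** (2008)
293–400, §1, Proposition 1.10 (vi) and its proof, kurims text pp. 35–36
[cite: MochizukiFrdI2008, Prop. 1.10(vi)]:

> "(vi) The Frobenioid `C^istr` is of sub-quasi-Frobenius-trivial type. Moreover, every group-like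
> object `A ∈ Ob(C^istr)` is Frobenius-trivial."

PROVED along the printed proof (p. 36), which uses only that `C^istr` is a Frobenioid
(Prop. 1.9 (v)) all of whose morphisms are co-angular (Prop. 1.4 (i)); accordingly the argument is
recorded for an arbitrary Frobenioid of isotropic type (`…_of_isOfIsotropicType`) and then
specialised to `C^istr`: Def. 1.3 (i)(a)(b) give co-angular pre-steps `α : B → A`, `γ : B → C`
with `C` Frobenius-trivial; Prop. 1.10 (ii) rewrites `φ_C ∘ γ = γ' ∘ ψ`; by Def. 1.3 (iii)(d),
`γ'` factors through `γ`, giving a base-identity endomorphism of `B` of any prescribed degree; for a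
group-like `A` the pre-steps are isomorphisms by Prop. 1.4 (iii). No statement of the paper is
strengthened.
-/

namespace Literature.AlgebraicGeometry.Frobenioids

open CategoryTheory Opposite

universe w v v' u u'

namespace PreFrobenioid

variable {D : Type u} [Category.{v} D] {Φ : Dᵒᵖ ⥤ CommMonCat.{w}}
  {C : Type u'} [Category.{v'} C] {F : C ⥤ ElemFrobenioid Φ}

/-- In a Frobenioid of isotropic type every object receives a (co-angular) pre-step from a
quasi-Frobenius-trivial object (the argument of the proof of Prop. 1.10 (vi), p. 36).
[cite: MochizukiFrdI2008, Prop. 1.10(vi) p.36] -/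
theorem isSubQuasiFrobeniusTrivial_of_isOfIsotropicType (hF : IsFrobenioid F)
    (histr : IsOfIsotropicType F) (A : C) : IsSubQuasiFrobeniusTrivial F A := by
  have hP := hF.isPreFrobenioid
  have hD := hP.isTotallyEpimorphic_base
  have hco : ∀ {X Y : C} (g : X ⟶ Y), IsCoAngular F g :=
    fun g => isCoAngular_of_isIsotropic_codomains F g (fun Y _ => histr Y)
  -- `α : B → A`, `γ : B → C₀` pre-steps with `C₀` Frobenius-trivial (Def. 1.3 (i)(a)(b))
  obtain ⟨C₀, hC₀, ⟨i⟩⟩ := hF.i_a (baseObj F A)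
  obtain ⟨B, γ, α, hγ, hα, -⟩ := hF.i_b C₀ A i
  obtain ⟨ζ, hζ⟩ := hC₀
  refine ⟨B, α, hco α, hα, fun d => ?_⟩
  obtain ⟨hζd, hζb, hζf⟩ := hζ d
  set f : C₀ ⟶ C₀ := ζ d with hf_def
  -- Prop. 1.10 (ii): `γ ≫ φ_C = ψ ≫ γ'`
  obtain ⟨B', ψ, γ', hψ, hγ'pre, hsq, hψd, hDγ'⟩ :=
    exists_frobeniusType_preStep_swap hF γ hγ f hζf
  have hγc : IsCoAngularPreStep F γ := ⟨hco γ, hγ⟩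
  have hγ'c : IsCoAngularPreStep F γ' := ⟨hco γ', hγ'pre⟩
  haveI : IsIso (Base F γ) := hγ.2
  haveI : IsIso (Base F γ') := hγ'pre.2
  haveI : IsIso (Base F ψ) := hψ.2
  -- `(γ^*)⁻¹ Div γ` divides `(γ'^*)⁻¹ Div γ' = ((γ^*)⁻¹ Div γ)^d` (Def. 1.3 (iii)(d))
  have hbase : Base F γ' = inv (Base F ψ) ≫ Base F γ := by
    have h := congrArg (Base F) hsq
    rw [base_comp, base_comp, show Base F f = 𝟙 _ from hζb, Category.comp_id] at h
    rw [IsIso.eq_inv_comp, h]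
  have hinv : invDiv F γ' hγ'c.2.2 = (invDiv F γ hγc.2.2) ^ (degFr F f : ℕ) := by
    show pull Φ (inv (Base F γ')) (Div F γ') = (pull Φ (inv (Base F γ)) (Div F γ)) ^ _
    have hb' : inv (Base F γ') = inv (Base F γ) ≫ Base F ψ := by
      apply IsIso.inv_eq_of_hom_inv_id
      rw [hbase, Category.assoc, IsIso.hom_inv_id_assoc, IsIso.inv_hom_id]
    rw [hDγ', hb', pull_comp, map_pow, ← pull_comp Φ (Base F ψ), IsIso.hom_inv_id, pull_id, map_pow]
  obtain ⟨β, hβ, hβγ⟩ := hF.iii_d_over_full γ' γ hγ'c hγc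
    (by rw [hinv]; exact dvd_pow_self _ (PNat.ne_zero _))
  -- `φ_B := ψ ≫ β` is a base-identity endomorphism of degree `d`
  refine ⟨ψ ≫ β, ?_, ?_⟩
  · have h1 : (ψ ≫ β) ≫ γ = γ ≫ f := by rw [Category.assoc, hβγ, hsq]
    have h2 := congrArg (Base F) h1
    rw [base_comp, base_comp, base_comp, show Base F f = 𝟙 _ from hζb, Category.comp_id] at h2
    show Base F (ψ ≫ β) = 𝟙 _
    rw [← cancel_mono (Base F γ), base_comp, h2, Category.id_comp]
  · rw [degFr_comp, hψd, show degFr F β = 1 from hβ.2.1, mul_one, hζd]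

/-- **Prop. 1.10 (vi)**, general form: a Frobenioid of isotropic type is of
sub-quasi-Frobenius-trivial type. [cite: MochizukiFrdI2008, Prop. 1.10(vi) p.35] -/
theorem isOfType_isSubQuasiFrobeniusTrivial_of_isOfIsotropicType (hF : IsFrobenioid F)
    (histr : IsOfIsotropicType F) : IsOfType (IsSubQuasiFrobeniusTrivial F) :=
  fun A => isSubQuasiFrobeniusTrivial_of_isOfIsotropicType hF histr A

/-- Group-likeness is inherited along base-isomorphisms (the pull-back map along an isomorphism of
`D` is bijective). [cite: MochizukiFrdI2008, Prop. 1.10(vi) p.36] -/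
theorem isGroupLikeObj_of_isBaseIso {A B : C} (φ : B ⟶ A) (hφ : IsBaseIso F φ)
    (hA : IsGroupLikeObj F A) : IsGroupLikeObj F B := by
  haveI : IsIso (Base F φ) := hφ
  intro x
  have : x = pull Φ (Base F φ) (pull Φ (inv (Base F φ)) x) := by
    rw [← pull_comp, IsIso.hom_inv_id, pull_id]
  rw [this, hA (pull Φ (inv (Base F φ)) x), map_one]

/-- In a Frobenioid of isotropic type every group-like object is Frobenius-trivial (the pre-steps
`A' → A`, `A' → A''` of Def. 1.3 (i)(a)(b) into group-like objects are isometric, hence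
LB-invertible pre-steps, hence isomorphisms by Prop. 1.4 (iii)).
[cite: MochizukiFrdI2008, Prop. 1.10(vi) p.36] -/
theorem isFrobeniusTrivial_of_isGroupLikeObj_of_isOfIsotropicType (hF : IsFrobenioid F)
    (histr : IsOfIsotropicType F) {A : C} (hA : IsGroupLikeObj F A) : IsFrobeniusTrivial F A := by
  have hP := hF.isPreFrobenioid
  have hco : ∀ {X Y : C} (g : X ⟶ Y), IsCoAngular F g :=
    fun g => isCoAngular_of_isIsotropic_codomains F g (fun Y _ => histr Y)
  obtain ⟨A'', hA'', ⟨i⟩⟩ := hF.i_a (baseObj F A)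
  obtain ⟨A', φ, ψ, hφ, hψ, -⟩ := hF.i_b A'' A i
  -- `A'`, `A''` are group-like too
  have hA' : IsGroupLikeObj F A' := isGroupLikeObj_of_isBaseIso ψ hψ.2 hA
  -- a pre-step out of a group-like object is an isometry, hence (being co-angular) an isomorphism
  have key : ∀ {Y : C} (g : A' ⟶ Y), IsPreStep F g → IsIso g := fun g hg =>
    isIso_of_isLBInvertible_of_isPreStep F hF g ⟨hco g, hA' (Div F g)⟩ hg
  haveI := key φ hφ
  haveI := key ψ hψ
  exact IsFrobeniusTrivial.of_iso F hF ((asIso φ).symm ≪≫ asIso ψ) hA''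

/-! ### Proposition 1.10 (vi) for `C^istr` -/

/-- **Prop. 1.10 (vi)**: "The Frobenioid `C^istr` is of sub-quasi-Frobenius-trivial type."
[cite: MochizukiFrdI2008, Prop. 1.10(vi) p.35] -/
theorem isOfType_isSubQuasiFrobeniusTrivial_istr (hF : IsFrobenioid F) :
    IsOfType (IsSubQuasiFrobeniusTrivial (istrFunctor F)) :=
  isOfType_isSubQuasiFrobeniusTrivial_of_isOfIsotropicType (isFrobenioid_istr hF)
    isOfIsotropicType_istr

/-- **Prop. 1.10 (vi)**: "Moreover, every group-like object `A ∈ Ob(C^istr)` is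
Frobenius-trivial." [cite: MochizukiFrdI2008, Prop. 1.10(vi) p.35] -/
theorem isFrobeniusTrivial_of_isGroupLikeObj_istr (hF : IsFrobenioid F) {A : Istr F}
    (hA : IsGroupLikeObj (istrFunctor F) A) : IsFrobeniusTrivial (istrFunctor F) A :=
  isFrobeniusTrivial_of_isGroupLikeObj_of_isOfIsotropicType (isFrobenioid_istr hF)
    isOfIsotropicType_istr hA

end PreFrobenioid

end Literature.AlgebraicGeometry.Frobenioids
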